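import Literature.Computation.Certificates.PosSemidefInt
import Literature.Computation.Certificates.GramSOSRows

/-!
# Packed Gram certificates: a kernel-cheap PSD check for large Gram blocks (`decide +kernel`)

Compute-infrastructure file (cell certnum, seat certnum-sdp-3; same discipline as unit
`infra-psd-sos-lp-checker`). The rounded PSD certificates of `PosSemidef.lean` /
`PosSemidefInt.lean` (`IsGramCertDD`, `IsGramCertZ`: weights `d ≥ 0`, factor `B`, residual
`A − Bᵀ·diag d·B` symmetric diagonally dominant) are checked by the kernel through `Fin`-indexed
`!![…]` literals and `Finset` sums; MEASURED on the farm (2026-08-26) this costs ≈ 35 min per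
Gram block of size `84` (18 row-block `decide`s) and does not reach size `120`, and already the
`!![…]` literal of an `84 × 84` rational matrix costs 13 s to elaborate and ≈ 47 s of kernel time
per pass of `s²` random accesses (`vecCons` walks are linear in the index). This file checks THE
SAME MATHEMATICAL CERTIFICATE from a PACKED presentation designed for the kernel's GMP
arithmetic:

* the symmetric integer matrix `A = den • Q` is ONE natural-number literal `R` — entry `(i, j)`
  is `(R >>> (w (n i + j))) % 2^w − 2^(w−1)` (`w` bits per entry, offset `2^(w−1)`, row-major),
  one GMP shift and one `mod` per access (`entry`, `intMatrix`, `toMatrix`);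
* factor row `i` (column `i` of `B`, i.e. `k ↦ B k i`) is THREE naturals `(p, r, t)`
  (`Row`): with offset digits `a_k = B k i + O ∈ [0, 2 O)`, `p = Σ_k a_k X^k` (little-endian,
  `X = 2^x`), `r = Σ_k d_k a_k X^(m−1−k)` (weighted, big-endian) and `t = Σ_k d_k a_k`; ONE peel
  pass per row (`peelOK`) verifies `r`, `t` and the digit bound;
* every weighted dot product `Σ_k d_k B_ki B_kj` is read off as the MIDDLE DIGIT of the single GMP
  product `p_i · r_j` (Kronecker substitution; exact because every convolution coefficient is
  `< X`, which the checker enforces through `m · max d · (2 O)² < X`), corrected for the offset by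
  `− O (t_i + t_j) + O² Σ d` (`midDigit`, `wdot`);
* the residual rows `A_i − (Bᵀ·diag d·B)_i` are formed on the fly and tested for diagonal
  dominance (`resRow`, `ddRowOK`, `ddAll`); symmetry of `A` is tested by `symmAll`.

`check n w den R x O d P : Bool` is the conjunction; measured cost of ONE `decide +kernel` at
default heartbeats on synthetic dense certificates: size `84` in 15.5 s (file 302 KB), size `120`
in 28.7 s (517 KB), law ≈ `n^2.45`. SOUNDNESS is REDUCED, not re-proved: `isGramCertZ_of_check`
shows that a passing check IS an integer rounded Gram certificate `PSD.IsGramCertZ` for the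
matrix `intMatrix n w R`, the weights `weights d` and the decoded factor `factor x O d P n`, so
Gershgorin (`PosSemidefInt.lean`) and the rational bridge give `quadForm_nonneg_of_check`,
`posSemidef_of_check`, and the SOS hook `SOS.GramSOS.quadNonneg_of_packed` (a Gram block whose
`Q` is written as `toMatrix s w den R` — a definitionally equal PRESENTATION of the same rational
matrix — satisfies `GramSOS.QuadNonneg`, the form-agnostic hypothesis of
`GramSOSRows.nonneg_of_quadGR`; the certificate format `CertG` is untouched).

## API (namespace `Literature.Computation.Certificates.PSD.Packed`)

* data access `entry`, `intMatrix`, `toMatrix`, `Row`; checker `peelOK`, `midDigit`, `wdot`,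
  `resRow`, `absSum`, `ddRowOK`, `ddAll`, `symmRow`, `symmAll`, `maxList`, `sumList`, `check`;
* digit arithmetic `dig`, `dig_succ`, `sum_dig_mul_pow`, `digit_of_expansion` (no-carry digit
  extraction), `middleDigit_eq` (Kronecker substitution), `peelOK_spec`;
* soundness `weights`, `rowOf`, `factor`, `isGramCertZ_of_check`, `isSymm_of_check`,
  `quadForm_nonneg_of_check`, `posSemidef_of_check`, `SOS.GramSOS.quadNonneg_of_packed`;
* a kernel-checked `example` (size 3) at the end; the producer-side packer is 40 lines of Python
  (`pack_gram(Q, d, B)` in the certnum cell, `pub/certnum/certnum-sdp-3/code/sosgram/packed.py`).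

Hypotheses / WHAT IS NOT CERTIFIED: the check certifies positive semidefiniteness of exactly the
matrix `toMatrix n w den R` (whatever the producer meant to pack — a wrong packing is caught only
if the CONSUMER states its matrix as `toMatrix …`, which the SOS hook forces by `hQ`); nothing is
claimed about the floating-point factor the digits came from.

## References

* D. Harvey, *Faster polynomial multiplication via multipoint Kronecker substitution*, J. Symb.
  Comput. 44 (2009) 1502–1510, §1 and §3.1 (standard Kronecker substitution: evaluate at `2^N`
  with `N` above the coefficient length, multiply, read the coefficients off the digits), §2.2
  (reciprocal evaluation points). [Harvey2009]
* G. Blekherman, P. Parrilo, R. Thomas (eds.), *Semidefinite Optimization and Convex Algebraic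
  Geometry*, SIAM 2012, App. A.1.2 (rounded Gram certificates), Thm 3.39 (Gram-matrix SOS).
  [BlekhermanParriloThomas2012]
* Gershgorin / the integer rounded certificate: `PosSemidefInt.lean` (reused, not re-proved).
-/

namespace Literature.Computation.Certificates

namespace PSD

namespace Packed

open Finset

/-! ### Data access -/

/-- Signed entry at linear position `pos` of the packed literal `R`: `w` bits per entry, stored
with offset `2^(w-1)`; read by one GMP shift and one `mod`. [folklore] -/
def entry (w R pos : ℕ) : ℤ :=
  (((R >>> (w * pos)) % 2 ^ w : ℕ) : ℤ) - ((2 ^ (w - 1) : ℕ) : ℤ)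

/-- The packed `n × n` integer matrix (row-major positions `n i + j`). [folklore] -/
def intMatrix (n w R : ℕ) : Matrix (Fin n) (Fin n) ℤ :=
  fun i j => entry w R (n * i.val + j.val)

/-- The packed matrix as a RATIONAL `Fin`-matrix with common denominator `den`:
`toMatrix n w den R i j = entry w R (n i + j) / den` — the presentation in which a Gram block's
matrix is written to use the packed certificate. [folklore] -/
def toMatrix (n w den R : ℕ) : Matrix (Fin n) (Fin n) ℚ :=
  fun i j => (entry w R (n * i.val + j.val) : ℚ) / (den : ℚ)

/-- One factor row of a packed certificate: `p = Σ_k a_k X^k` (offset digits `a_k = B k i + O`,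
little-endian), `r = Σ_k d_k a_k X^(m-1-k)` (weighted, big-endian), `t = Σ_k d_k a_k` — the
"packing" of Kronecker substitution. [cite: Harvey2009, §3.1] -/
structure Row where
  /-- `Σ_k a_k X^k` -/
  p : ℕ
  /-- `Σ_k d_k a_k X^(m-1-k)` -/
  r : ℕ
  /-- `Σ_k d_k a_k` -/
  t : ℕ

/-! ### The checker (kernel-evaluable: naturals, GMP operations, plain list recursion) -/

/-- ONE peel pass over the `|d|` digits of `p` (base `X`): every digit is `< A`, the accumulated
weighted big-endian repacking equals `r`, the accumulated weighted digit sum equals `t`, and `p`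
has no digit beyond position `|d| - 1`. [folklore] -/
def peelOK (X A : ℕ) : List ℕ → ℕ → ℕ → ℕ → ℕ → ℕ → Bool
  | dk :: ds, p, aR, aT, r, t =>
      decide (p % X < A) && peelOK X A ds (p / X) (aR * X + dk * (p % X)) (aT + dk * (p % X)) r t
  | [], p, aR, aT, r, t => (p == 0) && (aR == r) && (aT == t)

/-- The middle digit `z / X^(m-1) % X` (`XM = X^(m-1)` precomputed by the caller). [folklore] -/
def midDigit (X XM z : ℕ) : ℕ :=
  z / XM % X

/-- `Σ_k d_k B_ki B_kj` recovered from the packings of rows `i`, `j`: the middle digit of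
`p_i · r_j` is `Σ_k d_k a_ik a_jk`; subtract the offset terms. [folklore] -/
def wdot (X XM O D : ℕ) (qi qj : Row) : ℤ :=
  ((midDigit X XM (qi.p * qj.r) : ℕ) : ℤ) - ((O * (qi.t + qj.t) : ℕ) : ℤ) + ((O * O * D : ℕ) : ℤ)

/-- Residual row `i`, entries `j = j₀, j₀ + 1, …` along the list of row packings:
`A_ij − Σ_k d_k B_ki B_kj`. [folklore] -/
def resRow (n w R X XM O D i : ℕ) (qi : Row) : ℕ → List Row → List ℤ
  | _, [] => []
  | j, qj :: qs => (entry w R (n * i + j) - wdot X XM O D qi qj) :: resRow n w R X XM O D i qi (j + 1) qs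

/-- `Σ_j |v_j|` of an integer list. [folklore] -/
def absSum : List ℤ → ℤ
  | [] => 0
  | a :: as => (a.natAbs : ℤ) + absSum as

/-- Row `i` of a residual is diagonally dominant with nonnegative diagonal:
`Σ_{j ≠ i} |v_j| ≤ v_i`. [folklore] -/
def ddRowOK (i : ℕ) (v : List ℤ) : Bool :=
  decide (absSum v - ((v.getD i 0).natAbs : ℤ) ≤ v.getD i 0)

/-- Diagonal dominance of all residual rows `i = i₀, i₀ + 1, …` (one `resRow` each). [folklore] -/
def ddAll (n w R X XM O D : ℕ) (P : List Row) : ℕ → List Row → Bool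
  | _, [] => true
  | i, qi :: qs => ddRowOK i (resRow n w R X XM O D i qi 0 P) && ddAll n w R X XM O D P (i + 1) qs

/-- Symmetry of row `i` against the columns `j < j₀`: `A_ij = A_ji`. [folklore] -/
def symmRow (n w R i : ℕ) : ℕ → Bool
  | 0 => true
  | j + 1 => (entry w R (n * i + j) == entry w R (n * j + i)) && symmRow n w R i j

/-- Symmetry of the packed matrix on the rows `i < i₀` (strict lower triangle). [folklore] -/
def symmAll (n w R : ℕ) : ℕ → Bool
  | 0 => true
  | i + 1 => symmRow n w R i i && symmAll n w R i

/-- Maximum of a list of naturals (`0` for `[]`). [folklore] -/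
def maxList (l : List ℕ) : ℕ :=
  l.foldr max 0

/-- Sum of a list of naturals. [folklore] -/
def sumList (l : List ℕ) : ℕ :=
  l.foldr (· + ·) 0

/-- **The packed Gram certificate check**: `den > 0`; `A` symmetric; one row packing per index;
every packing consistent with digits `< 2 O`; the no-carry bound `m · max d · (2 O)² < X`; the
residual `A − Bᵀ·diag d·B` diagonally dominant row by row. Discharge by `decide +kernel`.
[folklore] -/
def check (n w den R x O : ℕ) (d : List ℕ) (P : List Row) : Bool :=
  let X := 2 ^ x
  let m := d.length
  let XM := X ^ (m - 1)
  decide (0 < den) && symmAll n w R n && (P.length == n) &&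
    P.all (fun q => peelOK X (2 * O) d q.p 0 0 q.r q.t) &&
    decide (m * maxList d * (2 * O) ^ 2 < X) &&
    ddAll n w R X XM O (sumList d) P 0 P

/-! ### Digit arithmetic -/

/-- Digit `k` of `p` in base `X`. [folklore] -/
def dig (X p k : ℕ) : ℕ :=
  p / X ^ k % X

/-- Digit `0` is `p % X`. [folklore] -/
private theorem dig_zero (X p : ℕ) : dig X p 0 = p % X := by
  simp [dig]

/-- Digit `k + 1` of `p` is digit `k` of `p / X`. [folklore] -/
private theorem dig_succ (X p k : ℕ) : dig X p (k + 1) = dig X (p / X) k := by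
  unfold dig
  rw [pow_succ', ← Nat.div_div_eq_div_mul]

/-- **Base-`X` expansion**: a number below `X^m` is the sum of its `m` digits (the "unpacking"
step of Kronecker substitution). [cite: Harvey2009, §1 and §3.1] -/
theorem sum_dig_mul_pow {X : ℕ} (hX : 0 < X) :
    ∀ (m p : ℕ), p < X ^ m → ∑ k ∈ range m, dig X p k * X ^ k = p
  | 0, p, hp => by
      have : p = 0 := by simpa using hp
      simp [this]
  | m + 1, p, hp => by
      have hp' : p / X < X ^ m := (Nat.div_lt_iff_lt_mul hX).2 (by simpa [pow_succ] using hp)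
      have ih := sum_dig_mul_pow hX m (p / X) hp'
      rw [Finset.sum_range_succ', dig_zero, pow_zero, mul_one]
      have h1 : ∑ k ∈ range m, dig X p (k + 1) * X ^ (k + 1) =
          X * ∑ k ∈ range m, dig X (p / X) k * X ^ k := by
        rw [Finset.mul_sum]
        exact Finset.sum_congr rfl fun k _ => by rw [dig_succ, pow_succ]; ring
      rw [h1, ih]
      exact Nat.div_add_mod p X

/-- **No-carry digit extraction** (Kronecker substitution, unpacking): if `z = Σ_{e<E} c_e X^e`
with every `c_e < X` ("the choice of evaluation point ensures that the coefficients do not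
overlap"), then digit `t` of `z` is `c_t` (`0` beyond `E`). [cite: Harvey2009, §1 and §3.1] -/
theorem digit_of_expansion {X : ℕ} (hX : 0 < X) :
    ∀ (E : ℕ) (c : ℕ → ℕ), (∀ e < E, c e < X) →
      ∀ t, (∑ e ∈ range E, c e * X ^ e) / X ^ t % X = if t < E then c t else 0
  | 0, c, _, t => by simp
  | E + 1, c, hc, t => by
      have hz : ∑ e ∈ range (E + 1), c e * X ^ e = c 0 + X * ∑ e ∈ range E, c (e + 1) * X ^ e := by
        rw [Finset.sum_range_succ', pow_zero, mul_one, Finset.mul_sum, add_comm]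
        congr 1
        exact Finset.sum_congr rfl fun e _ => by rw [pow_succ]; ring
      have h0 : c 0 < X := hc 0 (Nat.succ_pos E)
      rw [hz]
      cases t with
      | zero =>
          rw [pow_zero, Nat.div_one, Nat.add_mul_mod_self_left, Nat.mod_eq_of_lt h0]
          simp
      | succ t =>
          rw [pow_succ', ← Nat.div_div_eq_div_mul, Nat.add_mul_div_left _ _ hX,
            Nat.div_eq_of_lt h0, zero_add,
            digit_of_expansion hX E (fun e => c (e + 1)) (fun e he => hc (e + 1) (by omega)) t]
          simp

/-- **Kronecker substitution (the middle digit)**: for digit sequences `a, b` of length `m` with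
`a_k ≤ amax`, `b_l ≤ bmax` and `m · amax · bmax < X`, digit `m − 1` of
`(Σ_k a_k X^k) · (Σ_l b_l X^(m-1-l))` is the dot product `Σ_k a_k b_k` (the product polynomial's
coefficients are `≤ m · amax · bmax < X`, so they are the base-`X` digits of the integer product;
the reversed second factor puts the dot product at the middle coefficient).
[cite: Harvey2009, §3.1 (standard Kronecker substitution) and §2.2 (reciprocal evaluation)] -/
theorem middleDigit_eq {X m amax bmax : ℕ} (hX : 0 < X) (a b : ℕ → ℕ)
    (ha : ∀ k < m, a k ≤ amax) (hb : ∀ l < m, b l ≤ bmax) (hbound : m * amax * bmax < X) :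
    (∑ k ∈ range m, a k * X ^ k) * (∑ l ∈ range m, b l * X ^ (m - 1 - l)) / X ^ (m - 1) % X =
      ∑ k ∈ range m, a k * b k := by
  rcases Nat.eq_zero_or_pos m with rfl | hm
  · simp
  -- reflect the second factor: `b' l = b (m - 1 - l)`
  set b' : ℕ → ℕ := fun l => b (m - 1 - l) with hb'
  have hrefl : ∑ l ∈ range m, b l * X ^ (m - 1 - l) = ∑ l ∈ range m, b' l * X ^ l := by
    rw [← Finset.sum_range_reflect (fun l => b' l * X ^ l) m]
    refine Finset.sum_congr rfl fun l hl => ?_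
    have hl' : l < m := Finset.mem_range.1 hl
    simp only [hb']
    congr 2
    omega
  have hb'le : ∀ l < m, b' l ≤ bmax := fun l hl => hb _ (by omega)
  -- convolution coefficients
  set conv : ℕ → ℕ := fun e => ∑ k ∈ range m, ∑ l ∈ range m, if k + l = e then a k * b' l else 0
    with hconv
  have hinner : ∀ e k, k < m →
      (∑ l ∈ range m, if k + l = e then a k * b' l else 0) =
        if k ≤ e ∧ e - k < m then a k * b' (e - k) else 0 := by
    intro e k hk
    have h1 : ∀ l, (k + l = e) = (k ≤ e ∧ l = e - k) := fun l => propext (by omega)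
    simp_rw [h1]
    by_cases hke : k ≤ e
    · simp only [hke, true_and]
      rw [Finset.sum_ite_eq' (range m) (e - k) (fun l => a k * b' l)]
      simp [Finset.mem_range]
    · simp [hke]
  have hconv_le : ∀ e, conv e ≤ m * amax * bmax := by
    intro e
    simp only [hconv]
    calc ∑ k ∈ range m, ∑ l ∈ range m, (if k + l = e then a k * b' l else 0)
        ≤ ∑ k ∈ range m, amax * bmax := by
          refine Finset.sum_le_sum fun k hk => ?_
          have hk' := Finset.mem_range.1 hk
          rw [hinner e k hk']
          split_ifs with h
          · exact Nat.mul_le_mul (ha k hk') (hb'le _ h.2)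
          · exact Nat.zero_le _
      _ = m * amax * bmax := by rw [Finset.sum_const, Finset.card_range, smul_eq_mul, mul_assoc]
  have hconv_lt : ∀ e < 2 * m - 1, conv e < X := fun e _ => lt_of_le_of_lt (hconv_le e) hbound
  -- the product is the expansion with coefficients `conv`
  have hprod : (∑ k ∈ range m, a k * X ^ k) * (∑ l ∈ range m, b' l * X ^ l) =
      ∑ e ∈ range (2 * m - 1), conv e * X ^ e := by
    have hL : (∑ k ∈ range m, a k * X ^ k) * (∑ l ∈ range m, b' l * X ^ l) =
        ∑ k ∈ range m, ∑ l ∈ range m, a k * b' l * X ^ (k + l) := by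
      rw [Finset.sum_mul_sum]
      exact Finset.sum_congr rfl fun k _ => Finset.sum_congr rfl fun l _ => by rw [pow_add]; ring
    have hR : ∑ e ∈ range (2 * m - 1), conv e * X ^ e =
        ∑ k ∈ range m, ∑ l ∈ range m, a k * b' l * X ^ (k + l) := by
      simp only [hconv, Finset.sum_mul]
      rw [Finset.sum_comm]
      refine Finset.sum_congr rfl fun k hk => ?_
      rw [Finset.sum_comm]
      refine Finset.sum_congr rfl fun l hl => ?_
      have hk' := Finset.mem_range.1 hk
      have hl' := Finset.mem_range.1 hl
      have hmem : k + l ∈ range (2 * m - 1) := Finset.mem_range.2 (by omega)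
      simp only [ite_mul, zero_mul]
      rw [Finset.sum_ite_eq, if_pos hmem]
    rw [hL, hR]
  -- the middle coefficient is the dot product
  have hmid : conv (m - 1) = ∑ k ∈ range m, a k * b k := by
    simp only [hconv]
    refine Finset.sum_congr rfl fun k hk => ?_
    have hk' := Finset.mem_range.1 hk
    rw [hinner (m - 1) k hk']
    have h1 : k ≤ m - 1 ∧ m - 1 - k < m := by omega
    simp only [h1, and_self, if_true, hb']
    congr 2
    omega
  rw [hrefl, hprod, digit_of_expansion hX (2 * m - 1) conv hconv_lt (m - 1)]
  have h2 : m - 1 < 2 * m - 1 := by omega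
  simp only [h2, if_true, hmid]

/-- **Semantics of the peel pass**: all `|d|` digits of `p` are `< A`, `p < X^|d|`, and `r`, `t`
are the weighted big-endian repacking / weighted digit sum of the digits (on top of the
accumulators) — the "packing" step of Kronecker substitution. [cite: Harvey2009, §3.1] -/
theorem peelOK_spec {X A : ℕ} (hX : 0 < X) :
    ∀ (ds : List ℕ) (p aR aT r t : ℕ), peelOK X A ds p aR aT r t = true →
      (∀ k < ds.length, dig X p k < A) ∧ p < X ^ ds.length ∧
      r = aR * X ^ ds.length +
          ∑ k ∈ range ds.length, ds.getD k 0 * dig X p k * X ^ (ds.length - 1 - k) ∧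
      t = aT + ∑ k ∈ range ds.length, ds.getD k 0 * dig X p k
  | [], p, aR, aT, r, t, h => by
      simp only [peelOK, Bool.and_eq_true, beq_iff_eq] at h
      obtain ⟨⟨hp, hr⟩, ht⟩ := h
      subst hp; subst hr; subst ht
      simp
  | dk :: ds, p, aR, aT, r, t, h => by
      simp only [peelOK, Bool.and_eq_true, decide_eq_true_eq] at h
      obtain ⟨h0, h1⟩ := h
      obtain ⟨hd, hp, hr, ht⟩ := peelOK_spec hX ds (p / X) _ _ r t h1
      refine ⟨?_, ?_, ?_, ?_⟩
      · intro k hk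
        cases k with
        | zero => simpa [dig_zero] using h0
        | succ k =>
            rw [dig_succ]
            exact hd k (by simpa using hk)
      · rw [List.length_cons, pow_succ]
        exact (Nat.div_lt_iff_lt_mul hX).1 hp
      · rw [hr, List.length_cons, Finset.sum_range_succ']
        simp only [List.getD_cons_succ, List.getD_cons_zero, dig_succ, dig_zero,
          Nat.add_sub_cancel, Nat.sub_zero]
        have h2 : ∀ k ∈ range ds.length,
            ds.getD k 0 * dig X (p / X) k * X ^ (ds.length - (k + 1)) =
              ds.getD k 0 * dig X (p / X) k * X ^ (ds.length - 1 - k) := by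
          intro k _
          congr 2
          omega
        rw [Finset.sum_congr rfl h2, pow_succ]
        ring
      · rw [ht, List.length_cons, Finset.sum_range_succ']
        simp only [List.getD_cons_succ, List.getD_cons_zero, dig_succ, dig_zero]
        ring

/-! ### List bookkeeping -/

/-- `absSum` is the sum of the absolute values of the entries. [folklore] -/
private theorem absSum_eq : ∀ v : List ℤ, absSum v = ∑ k ∈ range v.length, ((v.getD k 0).natAbs : ℤ)
  | [] => by simp [absSum]
  | a :: as => by
      rw [absSum, absSum_eq as, List.length_cons, Finset.sum_range_succ']
      simp [add_comm]

/-- Length of a residual row. [folklore] -/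
private theorem length_resRow (n w R X XM O D i : ℕ) (qi : Row) :
    ∀ (j : ℕ) (qs : List Row), (resRow n w R X XM O D i qi j qs).length = qs.length
  | _, [] => rfl
  | j, _ :: qs => by simp [resRow, length_resRow n w R X XM O D i qi (j + 1) qs]

/-- Entries of a residual row. [folklore] -/
private theorem getD_resRow (n w R X XM O D i : ℕ) (qi : Row) :
    ∀ (j : ℕ) (qs : List Row) (k : ℕ), k < qs.length →
      (resRow n w R X XM O D i qi j qs).getD k 0 =
        entry w R (n * i + (j + k)) - wdot X XM O D qi (qs.getD k ⟨0, 0, 0⟩)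
  | _, [], k, hk => by simp at hk
  | j, qj :: qs, 0, _ => by simp [resRow]
  | j, qj :: qs, k + 1, hk => by
      simp only [resRow, List.getD_cons_succ]
      rw [getD_resRow n w R X XM O D i qi (j + 1) qs k (by simpa using hk)]
      simp only [add_assoc, add_comm 1 k]

/-- Semantics of `ddAll`: every row from `i₀` on passes `ddRowOK`. [folklore] -/
private theorem ddAll_spec (n w R X XM O D : ℕ) (P : List Row) :
    ∀ (i₀ : ℕ) (qs : List Row), ddAll n w R X XM O D P i₀ qs = true →
      ∀ k < qs.length, ddRowOK (i₀ + k) (resRow n w R X XM O D (i₀ + k) (qs.getD k ⟨0, 0, 0⟩) 0 P) = true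
  | _, [], _, k, hk => by simp at hk
  | i₀, qi :: qs, h, k, hk => by
      simp only [ddAll, Bool.and_eq_true] at h
      cases k with
      | zero => simpa using h.1
      | succ k =>
          have := ddAll_spec n w R X XM O D P (i₀ + 1) qs h.2 k (by simpa using hk)
          simpa [add_assoc, add_comm 1 k] using this

/-- Semantics of `symmRow`. [folklore] -/
private theorem symmRow_spec (n w R i : ℕ) :
    ∀ j₀, symmRow n w R i j₀ = true → ∀ j < j₀, entry w R (n * i + j) = entry w R (n * j + i)
  | 0, _, j, hj => (Nat.not_lt_zero j hj).elim
  | j₀ + 1, h, j, hj => by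
      simp only [symmRow, Bool.and_eq_true, beq_iff_eq] at h
      rcases Nat.lt_succ_iff_lt_or_eq.1 hj with hj' | rfl
      · exact symmRow_spec n w R i j₀ h.2 j hj'
      · exact h.1

/-- Semantics of `symmAll`. [folklore] -/
private theorem symmAll_spec (n w R : ℕ) :
    ∀ i₀, symmAll n w R i₀ = true → ∀ i < i₀, ∀ j < i, entry w R (n * i + j) = entry w R (n * j + i)
  | 0, _, i, hi, _, _ => (Nat.not_lt_zero i hi).elim
  | i₀ + 1, h, i, hi, j, hj => by
      simp only [symmAll, Bool.and_eq_true] at h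
      rcases Nat.lt_succ_iff_lt_or_eq.1 hi with hi' | rfl
      · exact symmAll_spec n w R i₀ h.2 i hi' j hj
      · exact symmRow_spec n w R i i h.1 j hj

/-- `maxList` bounds every entry. [folklore] -/
private theorem getD_le_maxList : ∀ (l : List ℕ) (k : ℕ), l.getD k 0 ≤ maxList l
  | [], k => by simp [maxList]
  | a :: as, 0 => by simp [maxList, List.foldr]
  | a :: as, k + 1 => by
      simp only [List.getD_cons_succ, maxList, List.foldr_cons]
      exact le_trans (getD_le_maxList as k) (le_max_right _ _)

/-- `sumList` is the sum of the entries. [folklore] -/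
private theorem sumList_eq : ∀ l : List ℕ, sumList l = ∑ k ∈ range l.length, l.getD k 0
  | [] => by simp [sumList]
  | a :: as => by
      have ih := sumList_eq as
      simp only [sumList, List.foldr_cons] at ih ⊢
      rw [ih, List.length_cons, Finset.sum_range_succ']
      simp [add_comm]

/-! ### Soundness: a passing check is an integer rounded Gram certificate -/

/-- The weights as a `Fin`-indexed vector. [folklore] -/
def weights (d : List ℕ) : Fin d.length → ℕ :=
  fun k => d.getD k.val 0

/-- Row packing number `i` (default beyond the list). [folklore] -/
def rowOf (P : List Row) (i : ℕ) : Row :=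
  P.getD i ⟨0, 0, 0⟩

/-- The decoded factor `B k i = (digit k of p_i) − O`. [folklore] -/
def factor (x O : ℕ) (d : List ℕ) (P : List Row) (n : ℕ) : Matrix (Fin d.length) (Fin n) ℤ :=
  fun k i => ((dig (2 ^ x) (rowOf P i.val).p k.val : ℕ) : ℤ) - (O : ℤ)

/-- The dot-product identity behind `wdot`: for two rows passing the peel test under the no-carry
bound, `wdot` IS `Σ_k d_k (a_ik − O)(a_jk − O)`. [folklore] -/
private theorem wdot_eq {x O : ℕ} {d : List ℕ} {qi qj : Row}
    (hi : peelOK (2 ^ x) (2 * O) d qi.p 0 0 qi.r qi.t = true)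
    (hj : peelOK (2 ^ x) (2 * O) d qj.p 0 0 qj.r qj.t = true)
    (hbound : d.length * maxList d * (2 * O) ^ 2 < 2 ^ x) :
    wdot (2 ^ x) ((2 ^ x) ^ (d.length - 1)) O (sumList d) qi qj =
      ∑ k ∈ range d.length, (d.getD k 0 : ℤ) *
        ((((dig (2 ^ x) qi.p k : ℕ) : ℤ) - O) * (((dig (2 ^ x) qj.p k : ℕ) : ℤ) - O)) := by
  have hX : 0 < 2 ^ x := Nat.two_pow_pos x
  set X := 2 ^ x with hXdef
  obtain ⟨hdi, hpi, _, hti⟩ := peelOK_spec hX d qi.p 0 0 qi.r qi.t hi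
  obtain ⟨hdj, _, hrj, htj⟩ := peelOK_spec hX d qj.p 0 0 qj.r qj.t hj
  simp only [zero_mul, zero_add] at hrj hti htj
  -- the middle digit
  have hmid : midDigit X (X ^ (d.length - 1)) (qi.p * qj.r) =
      ∑ k ∈ range d.length, dig X qi.p k * (d.getD k 0 * dig X qj.p k) := by
    have key := middleDigit_eq hX (fun k => dig X qi.p k) (fun l => d.getD l 0 * dig X qj.p l)
      (m := d.length) (amax := 2 * O - 1) (bmax := maxList d * (2 * O - 1)) ?_ ?_ ?_
    · rw [sum_dig_mul_pow hX d.length qi.p hpi, ← hrj] at key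
      exact key
    · intro k hk; have := hdi k hk; omega
    · intro l hl
      exact Nat.mul_le_mul (getD_le_maxList d l) (by have := hdj l hl; omega)
    · calc d.length * (2 * O - 1) * (maxList d * (2 * O - 1))
          = d.length * maxList d * ((2 * O - 1) * (2 * O - 1)) := by ring
        _ ≤ d.length * maxList d * (2 * O) ^ 2 := by
            apply Nat.mul_le_mul_left
            rw [sq]
            exact Nat.mul_le_mul (Nat.sub_le _ _) (Nat.sub_le _ _)
        _ < X := hbound
  unfold wdot
  rw [hmid, hti, htj, sumList_eq d]
  push_cast
  simp only [mul_add, Finset.mul_sum, ← Finset.sum_add_distrib, ← Finset.sum_sub_distrib]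
  exact Finset.sum_congr rfl fun k _ => by ring

/-- **Soundness (reduction)**: a passing packed check is an integer rounded Gram certificate
`PSD.IsGramCertZ` for the packed matrix, the listed weights and the decoded factor (rounded Gram
certificate: `A − Bᵀ·diag d·B` diagonally dominant). [cite: BlekhermanParriloThomas2012, App. A.1.2] -/
theorem isGramCertZ_of_check {n w den R x O : ℕ} {d : List ℕ} {P : List Row}
    (h : check n w den R x O d P = true) :
    IsGramCertZ (intMatrix n w R) (weights d) (factor x O d P n) := by
  have hX : 0 < 2 ^ x := Nat.two_pow_pos x
  simp only [check, Bool.and_eq_true, decide_eq_true_eq, beq_iff_eq, List.all_eq_true] at h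
  obtain ⟨⟨⟨⟨⟨_, hsym⟩, hlen⟩, hpeel⟩, hbound⟩, hdd⟩ := h
  have hpeel' : ∀ i < n, peelOK (2 ^ x) (2 * O) d (rowOf P i).p 0 0 (rowOf P i).r (rowOf P i).t = true := by
    intro i hi
    have hmem : rowOf P i ∈ P := by
      simp only [rowOf, List.getD_eq_getElem?_getD]
      rw [List.getElem?_eq_getElem (by omega)]
      exact List.getElem_mem _
    exact hpeel _ hmem
  -- the residual entries
  have hres : ∀ i j : Fin n, gramResidualZ (intMatrix n w R) (weights d) (factor x O d P n) i j =
      entry w R (n * i.val + j.val) -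
        wdot (2 ^ x) ((2 ^ x) ^ (d.length - 1)) O (sumList d) (rowOf P i.val) (rowOf P j.val) := by
    intro i j
    rw [wdot_eq (hpeel' i i.isLt) (hpeel' j j.isLt) hbound, Finset.sum_range]
    rfl
  refine IsDiagDominantZ.intro (fun i j => ?_) (fun i => ?_)
  · -- symmetry
    simp only [gramResidualZ, intMatrix]
    have hA : entry w R (n * i.val + j.val) = entry w R (n * j.val + i.val) := by
      rcases lt_trichotomy i.val j.val with hij | hij | hij
      · exact (symmAll_spec n w R n hsym j j.isLt i hij).symm
      · rw [hij]
      · exact symmAll_spec n w R n hsym i i.isLt j hij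
    rw [hA]
    congr 1
    exact Finset.sum_congr rfl fun k _ => by ring
  · -- row `i` diagonal dominance
    set M := gramResidualZ (intMatrix n w R) (weights d) (factor x O d P n) with hM
    set row := resRow n w R (2 ^ x) ((2 ^ x) ^ (d.length - 1)) O (sumList d) i.val (rowOf P i.val) 0 P
      with hrowdef
    have hrow := ddAll_spec n w R (2 ^ x) ((2 ^ x) ^ (d.length - 1)) O (sumList d) P 0 P hdd i.val
      (by omega)
    simp only [zero_add] at hrow
    change ddRowOK i.val row = true at hrow
    simp only [ddRowOK, decide_eq_true_eq, absSum_eq] at hrow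
    have hlenrow : row.length = n := by rw [hrowdef, length_resRow, hlen]
    rw [hlenrow] at hrow
    have hf : ∀ (k : ℕ) (hk : k < n), row.getD k 0 = M i ⟨k, hk⟩ := by
      intro k hk
      rw [hrowdef, getD_resRow _ _ _ _ _ _ _ _ _ _ _ k (by rw [hlen]; exact hk), hres, zero_add]
      rfl
    have h1 : ∑ j : Fin n, |M i j| = ∑ k ∈ range n, ((row.getD k 0).natAbs : ℤ) := by
      rw [Finset.sum_range (fun k => ((row.getD k 0).natAbs : ℤ))]
      exact Finset.sum_congr rfl fun j _ => by rw [hf j.val j.isLt, Int.natCast_natAbs]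
    rw [Finset.sum_erase_eq_sub (Finset.mem_univ i), h1, ← Int.natCast_natAbs (M i i),
      ← hf i.val i.isLt]
    exact hrow

/-- `den > 0` for a passing check. [folklore] -/
private theorem den_pos_of_check {n w den R x O : ℕ} {d : List ℕ} {P : List Row}
    (h : check n w den R x O d P = true) : 0 < den := by
  simp only [check, Bool.and_eq_true, decide_eq_true_eq] at h
  exact h.1.1.1.1.1

/-- The integer matrix is `den •` the rational presentation, entrywise. [folklore] -/
private theorem intMatrix_cast_eq {n w den R : ℕ} (hden : 0 < den) (i j : Fin n) :
    (intMatrix n w R i j : ℚ) = (den : ℚ) * toMatrix n w den R i j := by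
  have hd : (den : ℚ) ≠ 0 := by exact_mod_cast hden.ne'
  simp only [intMatrix, toMatrix]
  field_simp

/-- **The packed matrix of a passing check is symmetric.**
[cite: BlekhermanParriloThomas2012, App. A.1.2] -/
theorem isSymm_of_check {n w den R x O : ℕ} {d : List ℕ} {P : List Row}
    (h : check n w den R x O d P = true) : (toMatrix n w den R).IsSymm := by
  have hs := (isGramCertZ_of_check h).isSymm
  refine Matrix.IsSymm.ext fun i j => ?_
  have hij : intMatrix n w R j i = intMatrix n w R i j := hs.apply i j
  simp only [intMatrix] at hij
  simp only [toMatrix, hij]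

/-- **Soundness (quadratic form)**: the quadratic form of the rational matrix `toMatrix n w den R` of
a passing packed check is nonnegative over any linearly ordered field (Gram factor + diagonally
dominant residual, Gershgorin). [cite: BlekhermanParriloThomas2012, App. A.1.2] -/
theorem quadForm_nonneg_of_check {R' : Type*} [Field R'] [LinearOrder R'] [IsStrictOrderedRing R']
    {n w den R x O : ℕ} {d : List ℕ} {P : List Row} (h : check n w den R x O d P = true)
    (v : Fin n → R') : 0 ≤ ∑ i, ∑ j, v i * (toMatrix n w den R i j : R') * v j :=
  (isGramCertZ_of_check h).quadForm_nonneg_of_smul (by exact_mod_cast den_pos_of_check h)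
    (intMatrix_cast_eq (den_pos_of_check h)) v

/-- **Soundness (`Matrix.PosSemidef`)** over a linearly ordered field with trivial star (e.g. `ℝ`).
[cite: BlekhermanParriloThomas2012, App. A.1.2] -/
theorem posSemidef_of_check {R' : Type*} [Field R'] [LinearOrder R'] [IsStrictOrderedRing R']
    [StarRing R'] [TrivialStar R'] {n w den R x O : ℕ} {d : List ℕ} {P : List Row}
    (h : check n w den R x O d P = true) :
    ((toMatrix n w den R).map (Rat.cast : ℚ → R')).PosSemidef :=
  (isGramCertZ_of_check h).posSemidef_of_smul (by exact_mod_cast den_pos_of_check h)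
    (intMatrix_cast_eq (den_pos_of_check h))

end Packed

end PSD

/-! ### The SOS hook: a Gram block presented through `PSD.Packed.toMatrix` -/

namespace SOS.GramSOS

/-- **Packed certificate ⇒ `QuadNonneg`**: a Gram block whose matrix is WRITTEN as
`PSD.Packed.toMatrix g.s w den R` (hypothesis `hQ`, `rfl` for a block emitted in that presentation)
and whose packed check passes has nonnegative quadratic form — the form-agnostic hypothesis of
`nonneg_of_quadGR` / `nonneg_of_quadG` (`GramSOSRows.lean`). [cite: BlekhermanParriloThomas2012, Thm 3.39] -/
theorem quadNonneg_of_packed {R' : Type*} [Field R'] [LinearOrder R'] [IsStrictOrderedRing R']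
    (g : GramSOS) {w den R x O : ℕ} {d : List ℕ} {P : List PSD.Packed.Row}
    (hQ : g.Q = PSD.Packed.toMatrix g.s w den R)
    (h : PSD.Packed.check g.s w den R x O d P = true) : g.QuadNonneg R' :=
  quadNonneg_of_gramCertZ g (PSD.Packed.isGramCertZ_of_check h)
    (c := (den : ℚ)) (by exact_mod_cast PSD.Packed.den_pos_of_check h)
    fun i j => by rw [hQ]; exact PSD.Packed.intMatrix_cast_eq (PSD.Packed.den_pos_of_check h) i j

end SOS.GramSOS

/-! ### Tests / usage templates (kernel-checked) -/

namespace PSD.Packed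

/-- Test data: the path-graph matrix `[[2,-1,0],[-1,2,-1],[0,-1,2]]`, packed with `4` bits per
entry (offset `8`), denominator `1`. [folklore] -/
private def test3_R : ℕ :=
  44970965114

/-- Test data: unit weights. [folklore] -/
private def test3_d : List ℕ :=
  [1, 1, 1]

/-- Test data: packed rows of the integer factor `B = [[1,-1,0],[0,1,-1],[0,0,1]]` (digit base
`2^7`, digit offset `2`); residual `A − BᵀB = diag(1,0,0)`. [folklore] -/
private def test3_P : List Row :=
  [⟨33027, 49410, 7⟩, ⟨33153, 16770, 6⟩, ⟨49282, 32899, 6⟩]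

/-- Test: the packed check passes in the kernel … -/
example : check 3 4 1 test3_R 7 2 test3_d test3_P = true := by
  decide +kernel

/-- … hence the presented rational matrix is positive semidefinite over `ℝ`. -/
example : ((toMatrix 3 4 1 test3_R).map (Rat.cast : ℚ → ℝ)).PosSemidef :=
  posSemidef_of_check (x := 7) (O := 2) (d := test3_d) (P := test3_P) (by decide +kernel)

/-- Test: the presentation decodes to the intended matrix (entry `(1,0) = -1`, `(1,1) = 2`). -/
example : toMatrix 3 4 1 test3_R 1 0 = -1 ∧ toMatrix 3 4 1 test3_R 1 1 = 2 := by
  constructor <;> decide +kernel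

end PSD.Packed

end Literature.Computation.Certificates
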